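import Summits.BirchSwinnertonDyer.Rank1Residual.X10.UnitRoad
import Summits.BirchSwinnertonDyer.Rank1Residual.X10.CMPartnerThetaFreeRecords09
import Summits.BirchSwinnertonDyer.Rank1Residual.X10.CMPartnerThetaFreeRecords16
import HarnessLib

/-!
# Class X10b (N2), the TRIVIAL-PARTNER road at `p = 3`: per-pair kernel RECORDS, part A (the two K-CM cells) —
# X_A3 (`MazurMainConjecture W 3`) AT THE PAIR for `408320p1` (`∏ c_ℓ = 18`) and the RANK-ONE cell
# `413440h1` (`∏ c_ℓ = 54`) from their congruent partner `256d1`, whose `3`-primary arithmetic is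
# TRIVIAL — Rubin-free and `μ`-certificate-free (cell `b2b-bsdres`, unit `b2b-bsdres-x10` = N2 class
# lead, gen 24)

HONEST FRAMING (run/shared/lean/b2b/bsd-rank1-residual/, verbatim in every file): the goal of the
cell is to DELETE the COMBINATION-SHAPED residual classes of the Birch–Swinnerton-Dyer formula for
ALL analytic-rank `≤ 1` elliptic curves over `ℚ` — "full BSD formula for every rank `≤ 1` curve in
class `C`" assembled STRICTLY from published theorems — so that the rank-`≤ 1` remainder becomes
exactly the CONSTRUCTION-SHAPED classes, which are TYPED (missing-input `Prop`s), NOT attempted.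
This is not "finishing BSD". Theorems only; NO definition, NO named fact; class X10b keeps its label
CONSTRUCTION-SHAPED (NEEDS X_A3, referee R82.3 / RESIDUAL-MAP §I N2); nothing is booked by this file;
everything is PER PAIR; no census number moves.

## What (x10 GEN 24, X10-AUDIT §30)

The K-CM records of these two cells (`CMPartnerThetaFreeRecords09/16`, x10 GEN 23:
`mazurMainConjecture_t408320p1_of_cm256d1_kernel`, `…_t413440h1_…`) reach X_A3 at the pair through
Rubin 1991 Thm. 12.3 (`hRu`) + Greenberg–Vatsal 2000 Thm. (1.4) (`hGV`) + the ONE analytic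
certificate `hC2` (a unit coefficient of `ϖ·L₃(f_{256d1}, α)`). The CM partner `256d1 = [0, -1, 0, -3, -1]`
has TRIVIAL `3`-primary arithmetic in Cremona's table (rank `0`, `#E(ℚ)_tors = 2`, `∏ c_ℓ = 2`,
`#Ш_an = 1`, `a₃ = 2` NON-anomalous; `L/Ω = 1/2`), so the TRIVIAL-PARTNER road
(`UnitRoad.mazurMainConjecture_three_of_ainvs_of_trivialPartner`, x10 GEN 24: Kato 2004 Thm. 17.4 (1)
`hkato`, Greenberg 1999 Thm. 4.1 `hGr`, the period unit `h5`/`h3`, `hGV`) gives the SAME conclusion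
WITHOUT `hRu` and WITHOUT `hC2`: the partner's Mazur main conjecture is a triviality (unit `3`-adic
`L`-function, `X(256d1/ℚ_∞)` of unit characteristic series) and `hGV` carries it along the kernel
congruence C1 (`CMPartnerKernel.torsionIso_cm256d1_t<E>`, GEN 23's dual Hesse certificates, consumed BY
NAME). The target's own arithmetic is irrelevant to the road: `408320p1` has `∏ c_ℓ = 18` and
`413440h1` has analytic rank ONE (`∏ c_ℓ = 54`) — the first N2 cell of analytic rank `1` whose X_A3 at
the pair carries no analytic certificate at all. Displayed binders: PUBLISHED `hkato`, `hGr`, `h5`,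
`h3`, `hGV`; CENSUS (Cremona `allbsd` row of `256d1`) `htamA : 3 ∤ ∏ c_ℓ(A)`, `hLA` (`L(A,1)/Ω_A` a
nonzero rational `3`-adic unit), `hSelA : #Sel_{3^∞}(A/ℚ) = 1`; instance binders. Kernel numerals
reused BY NAME (x10 GEN 19: `CMPartnerRecords.card_t408320p1_{3,7}`, `card_t413440h1_{3,7}`,
`CMPartnerCurves.card_cm256d1_3`). Per pair; class statement untouched; nothing booked.

References: K. Kato, Astérisque 295 (2004) Thm. 17.4 (1) [Kato2004Asterisque]; R. Greenberg, LNM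
1716 (1999) Thm. 4.1 [GreenbergLNM1716]; R. Greenberg, V. Vatsal, Invent. Math. 142 (2000) Thm.
(1.4) [GreenbergVatsal2000]; T. Fisher, *The Hessian of a genus one curve*, Proc. LMS 104 (2012) §13
[Fisher2012Hessian]; J. E. Cremona, tables [Cremona2006].
-/

set_option autoImplicit false

noncomputable section

open scoped Classical MatrixGroups ModularForm

open CongruenceSubgroup WeierstrassCurve Literature.NumberTheory.EllipticCurves
  Literature.NumberTheory.EllipticCurves.ModularForms Literature.NumberTheory.EllipticCurves.Rank1Residual
  Literature.NumberTheory.EllipticCurves.Rank1Residual.X11RankOneCertificates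
  Summit.BirchSwinnertonDyer.BirchSwinnertonDyer.Rank1Residual.IntModel
  Summit.BirchSwinnertonDyer.BirchSwinnertonDyer.Rank1Residual.X11RankOne
  Summit.BirchSwinnertonDyer.BirchSwinnertonDyer.Theorems.Rank1ResidualX1Defs

namespace Summit.BirchSwinnertonDyer.Rank1Residual.X10.UnitRoad

open Summit.BirchSwinnertonDyer.Rank1Residual.X10.CMPartnerRecords
  Summit.BirchSwinnertonDyer.Rank1Residual.X10.CMPartnerCurves
  Summit.BirchSwinnertonDyer.Rank1Residual.X10.CMPartnerKernel

/-- **X_A3 AT THE PAIR `(408320p1, 3)` by the TRIVIAL-PARTNER road, Rubin-free and `hC2`-free: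
`MazurMainConjecture W 3`.** Target `408320p1 = [0, -1, 0, 1365, -67033]` (`N = 408320 = 2^8 · 5 · 11 · 29`,
census image `3Ns`, Cartan field `ℚ(√-8)`; analytic rank `0`, `∏ c_ℓ = 18` — NOT a unit cell; `#Ẽ(𝔽₃) = 2`,
Frobenius witness `ℓ = 7`, `#Ẽ(𝔽₇) = 5`); partner `A = 256d1 = [0, -1, 0, -3, -1]` (CM by `ℤ[√-2]`;
`#Ã(𝔽₃) = 2`: good ordinary NON-anomalous; Cremona: rank `0`, `#A(ℚ)_tors = 2`, `∏ c_ℓ = 2`, `#Ш_an = 1`);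
C1 = `torsionIso_cm256d1_t408320p1` (dual Hesse certificate `(l : m) = (-760 : 1)`, x10 GEN 23). Displayed
binders: PUBLISHED `hkato`, `hGr`, `h5`, `h3`, `hGV`; census `htamA`, `hLA`, `hSelA`. Per pair; nothing booked.
[cite: GreenbergVatsal2000, Thm. (1.4) (arXiv p. 5)] [cite: Kato2004Asterisque, Thm. 17.4 (1) (p. 273)]
[cite: GreenbergLNM1716, Thm. 4.1 (p. 102) and Prop. 3.8 (p. 95)] [cite: Fisher2012Hessian, Thm. 13.2 and §13]
[cite: Cremona2006, Table 1 (Cremona labels 408320p1, 256d1)] -/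
theorem mazurMainConjecture_partner_u408320p1
    (hkato : ∀ (W : WeierstrassCurve ℚ) [W.IsElliptic] [W.IsGloballyMinimal] (p : ℕ) [Fact p.Prime]
      (κ : ZpExtension ℚ p) (γ : Field.absoluteGaloisGroup ℚ) (N : ℕ) [NeZero N]
      (f : CuspForm (Gamma0 N) 2), kato_divisibility W p (κ := κ) (γ := γ) (f := f))
    (hGr : greenberg_charValue_rankZero) (h5 : realPeriodRat_eq_unit_mul_plusPeriod)
    (h3 : realPeriodRat_eq_unit_mul_plusPeriod_three)
    (hGV : GreenbergVatsal2000.thm14_mainConjecture_transfer_of_torsionIso)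
    (W A : WeierstrassCurve ℚ) [W.IsElliptic] [W.IsGloballyMinimal] [A.IsElliptic] [A.IsGloballyMinimal]
    [Fact (Nat.Prime 3)]
    (hW : W = ⟨0, -1, 0, 1365, -67033⟩) (hA : A = ⟨0, -1, 0, -3, -1⟩)
    (htamA : ¬ 3 ∣ A.tamagawaProduct)
    (hLA : ∃ q : ℚ, q ≠ 0 ∧ A.entireLFunction 1 / (A.realPeriodRat : ℂ) = (q : ℂ) ∧ padicValRat 3 q = 0)
    (hSelA : Nat.card (A.selmerGroupPInfty 3) = 1) :
    MazurMainConjecture W 3 := by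
  have hIW : integralModelInt W = ⟨0, -1, 0, 1365, -67033⟩ :=
    integralModelInt_eq_of_map_eq _ (by rw [hW]; ext <;> simp [WeierstrassCurve.map])
  have hIA : integralModelInt A = ⟨0, -1, 0, -3, -1⟩ :=
    integralModelInt_eq_of_map_eq _ (by rw [hA]; ext <;> simp [WeierstrassCurve.map])
  haveI : Fact (Nat.Prime 7) := ⟨by norm_num⟩
  exact mazurMainConjecture_three_of_ainvs_of_trivialPartner hkato hGr h5 h3 hGV
    0 (-1) 0 1365 (-67033) hIW 0 (-1) 0 (-3) (-1) hIA 7 5 2 2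
    (by decide +kernel) card_t408320p1_3 (by decide) (by decide) (by decide +kernel) card_t408320p1_7
    (by decide +kernel) (by decide +kernel) card_cm256d1_3 (by decide) (by decide) htamA hLA hSelA
    (torsionIso_cm256d1_t408320p1 W A hW hA)

/-- **X_A3 AT THE PAIR `(413440h1, 3)` — an N2 cell of ANALYTIC RANK ONE — by the TRIVIAL-PARTNER road,
Rubin-free and `hC2`-free: `MazurMainConjecture W 3`.** Target `413440h1 = [0, -1, 0, -5645, -586475]`
(`N = 413440 = 2^8 · 5 · 17 · 19`, census image `3Ns`; analytic rank `1`, `∏ c_ℓ = 54`; `#Ẽ(𝔽₃) = 5`, `a₃ = -1`;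
Frobenius witness `ℓ = 7`, `#Ẽ(𝔽₇) = 8`); partner `A = 256d1` as above; C1 = `torsionIso_cm256d1_t413440h1`
(dual Hesse certificate `(l : m) = (-1096 : 1)`, x10 GEN 23). Displayed binders: PUBLISHED `hkato`, `hGr`, `h5`,
`h3`, `hGV`; census `htamA`, `hLA`, `hSelA` — NO analytic certificate, NO Schneider certificate (the main
conjecture, not `BSD(E,3)`, is what is recorded). Per pair; nothing booked.
[cite: GreenbergVatsal2000, Thm. (1.4) (arXiv p. 5)] [cite: Kato2004Asterisque, Thm. 17.4 (1) (p. 273)]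
[cite: GreenbergLNM1716, Thm. 4.1 (p. 102) and Prop. 3.8 (p. 95)] [cite: Fisher2012Hessian, Thm. 13.2 and §13]
[cite: Cremona2006, Table 1 (Cremona labels 413440h1, 256d1)] -/
theorem mazurMainConjecture_partner_u413440h1
    (hkato : ∀ (W : WeierstrassCurve ℚ) [W.IsElliptic] [W.IsGloballyMinimal] (p : ℕ) [Fact p.Prime]
      (κ : ZpExtension ℚ p) (γ : Field.absoluteGaloisGroup ℚ) (N : ℕ) [NeZero N]
      (f : CuspForm (Gamma0 N) 2), kato_divisibility W p (κ := κ) (γ := γ) (f := f))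
    (hGr : greenberg_charValue_rankZero) (h5 : realPeriodRat_eq_unit_mul_plusPeriod)
    (h3 : realPeriodRat_eq_unit_mul_plusPeriod_three)
    (hGV : GreenbergVatsal2000.thm14_mainConjecture_transfer_of_torsionIso)
    (W A : WeierstrassCurve ℚ) [W.IsElliptic] [W.IsGloballyMinimal] [A.IsElliptic] [A.IsGloballyMinimal]
    [Fact (Nat.Prime 3)]
    (hW : W = ⟨0, -1, 0, -5645, -586475⟩) (hA : A = ⟨0, -1, 0, -3, -1⟩)
    (htamA : ¬ 3 ∣ A.tamagawaProduct)
    (hLA : ∃ q : ℚ, q ≠ 0 ∧ A.entireLFunction 1 / (A.realPeriodRat : ℂ) = (q : ℂ) ∧ padicValRat 3 q = 0)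
    (hSelA : Nat.card (A.selmerGroupPInfty 3) = 1) :
    MazurMainConjecture W 3 := by
  have hIW : integralModelInt W = ⟨0, -1, 0, -5645, -586475⟩ :=
    integralModelInt_eq_of_map_eq _ (by rw [hW]; ext <;> simp [WeierstrassCurve.map])
  have hIA : integralModelInt A = ⟨0, -1, 0, -3, -1⟩ :=
    integralModelInt_eq_of_map_eq _ (by rw [hA]; ext <;> simp [WeierstrassCurve.map])
  haveI : Fact (Nat.Prime 7) := ⟨by norm_num⟩
  exact mazurMainConjecture_three_of_ainvs_of_trivialPartner hkato hGr h5 h3 hGV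
    0 (-1) 0 (-5645) (-586475) hIW 0 (-1) 0 (-3) (-1) hIA 7 8 5 2
    (by decide +kernel) card_t413440h1_3 (by decide) (by decide) (by decide +kernel) card_t413440h1_7
    (by decide +kernel) (by decide +kernel) card_cm256d1_3 (by decide) (by decide) htamA hLA hSelA
    (torsionIso_cm256d1_t413440h1 W A hW hA)

end Summit.BirchSwinnertonDyer.Rank1Residual.X10.UnitRoad
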